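import Literature.NumberTheory.Sieve.FriedlanderIwaniecPrimesSmoothCutoff
import HarnessLib

/-!
# Friedlander–Iwaniec, *The polynomial `X² + Y⁴` captures its primes*, §4: the smooth partition (4.12)–(4.14)

Family `parity`, statement parity.S17. Source: J. Friedlander, H. Iwaniec, Ann. of Math. (2) 148
(1998), 945–1040 [FriedlanderIwaniecAnnals1998], §4, (4.12)–(4.15): "we reduce the range of the
inner sum of `B'(x; N)` to short segments of the type (4.12) `N' < n ≤ (1+θ)N'` … by means of a
smooth partition of unity. This amounts to changing `β(n)` into (4.13) `β(n) = p(n)μ(n)Σ_{c∣n, c≤C}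
μ(c)` where `p` is a smooth function supported on the segment (4.12) for some `N'` which satisfies
`N < N' < 2N`. It will be sufficient that `p` be twice differentiable with (4.14)
`p^{(j)} ≪ (θN)^{-j}`, `j = 0, 1, 2`. One needs at most `2θ⁻¹` such partition functions to cover
the whole interval `N < n ≤ 2N` with multiplicity one except for the points `n` with …
`|n - N| < θN` or `|n - 2N| < θN`."

This file CONSTRUCTS such a partition explicitly (the source does not fix one) and proves the
listed properties, for the sequel `FriedlanderIwaniecPrimesBilinearReduction`:

* `fiStep a δ` (`u ↦ ψ((u-a)/δ)`, `ψ = Real.smoothTransition`) and the bump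
  `fiBump a δ = fiStep a δ - fiStep (a+δ) δ` (smooth, values in `[0, 1]`, support in `(a, a+2δ)`),
  with `|fiBump'| ≤ 2M/δ`, `|fiBump''| ≤ 2M/δ²` for a bound `M` of `|ψ'|, |ψ''|`
  (`exists_bound_deriv_smoothTransition`, from the tree's `exists_bound_iteratedFDeriv_smoothTransition`);
* the partition of `(N, 2N]`: spacing `pouδ N θ = θN/2`, nodes `pouNode N θ k = N(1+θ/4) + kδ`
  (all in `(N, 2N)`), pieces `pouPiece N θ k = fiBump (u_k) δ` supported in
  `(u_k, u_k + θN] ⊆ (u_k, (1+θ)u_k]`, `pouCount θ = ⌊2/θ - 1/2⌋ - 1 ≤ 2/θ` pieces, with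
  `Σ_{k < K'} p_k ∈ [0, 1]` everywhere and `= 1` on `[u_1, u_{K'}] ⊇ [N + θN, 2N - θN]`
  (`sum_pouPiece_mem_Icc`, `sum_pouPiece_eq_one`, `residual_zone`), and the derivative bounds
  `|p_k'| ≤ 4M (θN)⁻¹`, `|p_k''| ≤ 8M (θN)⁻²` ((4.14) with explicit constants).

## References

* J. Friedlander, H. Iwaniec, Ann. of Math. (2) 148 (1998), 945–1040, §4, (4.12)–(4.15).
  [FriedlanderIwaniecAnnals1998]

## Tree / Mathlib

Tree: `exists_bound_iteratedFDeriv_smoothTransition` (`FriedlanderIwaniecPrimesSmoothCutoff`).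
Mathlib: `Real.smoothTransition` (`.monotone`, `.contDiff`, `.zero_of_nonpos`, `.one_of_one_le`),
`HasDerivAt.comp`, `ContDiff.differentiable_deriv_two`, `Finset.sum_range_sub'`. Mathlib's
`ContDiffBump`/`SmoothPartitionOfUnity` are not used: (4.14) needs explicit uniform derivative bounds
for a uniform family of bumps, which the elementary construction gives directly.
-/

noncomputable section

open Real Filter Finset
open scoped Topology

namespace Literature.NumberTheory.Sieve.FriedlanderIwaniecPrimes

/-! ### A smooth step and a smooth bump -/

/-- The smooth step `χ_{a,δ}(u) = ψ((u - a)/δ)` (`ψ = Real.smoothTransition`): `0` for `u ≤ a`, `1` for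
`u ≥ a + δ`, monotone, smooth. [folklore] -/
def fiStep (a δ u : ℝ) : ℝ := Real.smoothTransition ((u - a) / δ)

/-- `χ = 0` left of `a`. [folklore] -/
theorem fiStep_eq_zero {a δ u : ℝ} (hδ : 0 < δ) (hu : u ≤ a) : fiStep a δ u = 0 :=
  Real.smoothTransition.zero_of_nonpos (div_nonpos_of_nonpos_of_nonneg (by linarith) hδ.le)

/-- `χ = 1` right of `a + δ`. [folklore] -/
theorem fiStep_eq_one {a δ u : ℝ} (hδ : 0 < δ) (hu : a + δ ≤ u) : fiStep a δ u = 1 :=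
  Real.smoothTransition.one_of_one_le ((one_le_div hδ).mpr (by linarith))

/-- `0 ≤ χ`. [folklore] -/
theorem fiStep_nonneg (a δ u : ℝ) : 0 ≤ fiStep a δ u := Real.smoothTransition.nonneg _

/-- `χ ≤ 1`. [folklore] -/
theorem fiStep_le_one (a δ u : ℝ) : fiStep a δ u ≤ 1 := Real.smoothTransition.le_one _

/-- `χ_{a,δ}` decreases as `a` increases (`δ > 0`). [folklore] -/
theorem fiStep_anti_left {a a' δ : ℝ} (hδ : 0 < δ) (h : a ≤ a') (u : ℝ) :
    fiStep a' δ u ≤ fiStep a δ u :=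
  Real.smoothTransition.monotone (div_le_div_of_nonneg_right (by linarith) hδ.le)

/-- `χ_{a,δ}` is smooth. [folklore] -/
theorem contDiff_fiStep (a δ : ℝ) {n : ℕ∞} : ContDiff ℝ n (fiStep a δ) :=
  Real.smoothTransition.contDiff.comp ((contDiff_id.sub contDiff_const).div_const δ)

/-- `χ_{a,δ} = ψ ∘ (u ↦ (u - a)/δ)`. [folklore] -/
theorem fiStep_eq_comp (a δ : ℝ) : fiStep a δ = Real.smoothTransition ∘ fun u => (u - a) / δ := rfl

/-- `χ'_{a,δ}(u) = ψ'((u-a)/δ)/δ`. [folklore] -/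
theorem hasDerivAt_fiStep (a δ u : ℝ) :
    HasDerivAt (fiStep a δ) (deriv Real.smoothTransition ((u - a) / δ) / δ) u := by
  have hlin : HasDerivAt (fun u : ℝ => (u - a) / δ) (1 / δ) u :=
    ((hasDerivAt_id u).sub_const a).div_const δ
  have hψ : HasDerivAt Real.smoothTransition (deriv Real.smoothTransition ((u - a) / δ))
      ((u - a) / δ) :=
    ((Real.smoothTransition.contDiff (n := 1)).differentiable (by simp)).differentiableAt.hasDerivAt
  have h := hψ.comp u hlin
  rw [mul_one_div] at h
  rw [fiStep_eq_comp]
  exact h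

/-- `χ'_{a,δ}` as a function. [folklore] -/
theorem deriv_fiStep (a δ : ℝ) :
    deriv (fiStep a δ) = fun u => deriv Real.smoothTransition ((u - a) / δ) / δ :=
  funext fun u => (hasDerivAt_fiStep a δ u).deriv

/-- `χ''_{a,δ}(u) = ψ''((u-a)/δ)/δ²`. [folklore] -/
theorem deriv_deriv_fiStep (a δ : ℝ) :
    deriv (deriv (fiStep a δ)) =
      fun u => deriv (deriv Real.smoothTransition) ((u - a) / δ) / δ / δ := by
  rw [deriv_fiStep]
  funext u
  have hlin : HasDerivAt (fun u : ℝ => (u - a) / δ) (1 / δ) u :=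
    ((hasDerivAt_id u).sub_const a).div_const δ
  have hψ' : HasDerivAt (deriv Real.smoothTransition)
      (deriv (deriv Real.smoothTransition) ((u - a) / δ)) ((u - a) / δ) :=
    ((Real.smoothTransition.contDiff (n := 2)).differentiable_deriv_two).differentiableAt.hasDerivAt
  have h := ((hψ'.comp u hlin).div_const δ).deriv
  rw [mul_one_div] at h
  exact h

/-- A bound `M` for `|ψ'|` and `|ψ''|` (from `exists_bound_iteratedFDeriv_smoothTransition`).
[folklore] -/
theorem exists_bound_deriv_smoothTransition :
    ∃ M : ℝ, 1 ≤ M ∧ (∀ s, |deriv Real.smoothTransition s| ≤ M) ∧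
      ∀ s, |deriv (deriv Real.smoothTransition) s| ≤ M := by
  obtain ⟨M, hM1, hM⟩ := exists_bound_iteratedFDeriv_smoothTransition 2
  refine ⟨M, hM1, fun s => ?_, fun s => ?_⟩
  · have h := hM 1 (by norm_num) s
    rwa [norm_iteratedFDeriv_eq_norm_iteratedDeriv, iteratedDeriv_one, Real.norm_eq_abs] at h
  · have h := hM 2 le_rfl s
    rwa [norm_iteratedFDeriv_eq_norm_iteratedDeriv, show (2 : ℕ) = 1 + 1 from rfl,
      iteratedDeriv_succ, iteratedDeriv_one, Real.norm_eq_abs] at h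

/-- The smooth bump `b_{a,δ} = χ_{a,δ} - χ_{a+δ,δ}`: supported in `(a, a + 2δ)`, values in `[0, 1]`.
[folklore] -/
def fiBump (a δ u : ℝ) : ℝ := fiStep a δ u - fiStep (a + δ) δ u

/-- `0 ≤ b`. [folklore] -/
theorem fiBump_nonneg {a δ : ℝ} (hδ : 0 < δ) (u : ℝ) : 0 ≤ fiBump a δ u :=
  sub_nonneg.mpr (fiStep_anti_left hδ (by linarith) u)

/-- `b ≤ 1`. [folklore] -/
theorem fiBump_le_one (a δ u : ℝ) : fiBump a δ u ≤ 1 := by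
  unfold fiBump; linarith [fiStep_le_one a δ u, fiStep_nonneg (a + δ) δ u]

/-- `|b| ≤ 1` (`δ > 0`). [folklore] -/
theorem abs_fiBump_le_one {a δ : ℝ} (hδ : 0 < δ) (u : ℝ) : |fiBump a δ u| ≤ 1 :=
  abs_le.mpr ⟨by linarith [fiBump_nonneg (a := a) hδ u], fiBump_le_one a δ u⟩

/-- `b = 0` left of `a`. [folklore] -/
theorem fiBump_eq_zero_of_le {a δ u : ℝ} (hδ : 0 < δ) (hu : u ≤ a) : fiBump a δ u = 0 := by
  rw [fiBump, fiStep_eq_zero hδ hu, fiStep_eq_zero hδ (by linarith)]; ring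

/-- `b = 0` right of `a + 2δ`. [folklore] -/
theorem fiBump_eq_zero_of_ge {a δ u : ℝ} (hδ : 0 < δ) (hu : a + 2 * δ ≤ u) : fiBump a δ u = 0 := by
  rw [fiBump, fiStep_eq_one hδ (by linarith), fiStep_eq_one hδ (by linarith)]; ring

/-- The support of `b_{a,δ}` is inside `(a, a + 2δ)`. [folklore] -/
theorem fiBump_support {a δ u : ℝ} (hδ : 0 < δ) (h : fiBump a δ u ≠ 0) : a < u ∧ u < a + 2 * δ := by
  by_contra hc
  rw [not_and_or, not_lt, not_lt] at hc
  rcases hc with hc | hc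
  · exact h (fiBump_eq_zero_of_le hδ hc)
  · exact h (fiBump_eq_zero_of_ge hδ hc)

/-- `b_{a,δ}` is smooth. [folklore] -/
theorem contDiff_fiBump (a δ : ℝ) {n : ℕ∞} : ContDiff ℝ n (fiBump a δ) :=
  (contDiff_fiStep a δ).sub (contDiff_fiStep (a + δ) δ)

/-- `b'`. [folklore] -/
theorem deriv_fiBump (a δ : ℝ) :
    deriv (fiBump a δ) = fun u => deriv (fiStep a δ) u - deriv (fiStep (a + δ) δ) u := by
  funext u
  have h1 := hasDerivAt_fiStep a δ u
  have h2 := hasDerivAt_fiStep (a + δ) δ u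
  have h3 : HasDerivAt (fiBump a δ) (deriv Real.smoothTransition ((u - a) / δ) / δ -
      deriv Real.smoothTransition ((u - (a + δ)) / δ) / δ) u := h1.sub h2
  rw [h3.deriv, h1.deriv, h2.deriv]

/-- `b''`. [folklore] -/
theorem deriv_deriv_fiBump (a δ : ℝ) :
    deriv (deriv (fiBump a δ)) =
      fun u => deriv (deriv (fiStep a δ)) u - deriv (deriv (fiStep (a + δ) δ)) u := by
  rw [deriv_fiBump]
  funext u
  have hd : ∀ b : ℝ, Differentiable ℝ (deriv (fiStep b δ)) := fun b => by
    rw [deriv_fiStep]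
    have hψ' : Differentiable ℝ (deriv Real.smoothTransition) :=
      (Real.smoothTransition.contDiff (n := 2)).differentiable_deriv_two
    exact (hψ'.comp ((differentiable_id.sub_const b).div_const δ)).div_const δ
  exact deriv_sub (hd a u) (hd (a + δ) u)

/-- **Derivative bounds for the bump**: with `M` a bound for `|ψ'|, |ψ''|`,
`|b'| ≤ 2M/δ` and `|b''| ≤ 2M/δ²`. [folklore] -/
theorem abs_deriv_fiBump_le {M : ℝ} (hM : ∀ s, |deriv Real.smoothTransition s| ≤ M)
    (a : ℝ) {δ : ℝ} (hδ : 0 < δ) (u : ℝ) : |deriv (fiBump a δ) u| ≤ 2 * M / δ := by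
  rw [deriv_fiBump, deriv_fiStep, deriv_fiStep]
  simp only
  rw [← sub_div, abs_div, abs_of_pos hδ]
  apply div_le_div_of_nonneg_right _ hδ.le
  have h1 := hM ((u - a) / δ)
  have h2 := hM ((u - (a + δ)) / δ)
  calc |deriv smoothTransition ((u - a) / δ) - deriv smoothTransition ((u - (a + δ)) / δ)|
      ≤ |deriv smoothTransition ((u - a) / δ)| + |deriv smoothTransition ((u - (a + δ)) / δ)| :=
        abs_sub _ _
    _ ≤ M + M := add_le_add h1 h2
    _ = 2 * M := by ring

/-- See `abs_deriv_fiBump_le`. [folklore] -/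
theorem abs_deriv_deriv_fiBump_le {M : ℝ} (hM : ∀ s, |deriv (deriv Real.smoothTransition) s| ≤ M)
    (a : ℝ) {δ : ℝ} (hδ : 0 < δ) (u : ℝ) : |deriv (deriv (fiBump a δ)) u| ≤ 2 * M / δ ^ 2 := by
  rw [deriv_deriv_fiBump, deriv_deriv_fiStep, deriv_deriv_fiStep]
  simp only
  have hδ2 : 0 < δ ^ 2 := by positivity
  rw [div_div, div_div, ← sq, ← sub_div, abs_div, abs_of_pos hδ2]
  apply div_le_div_of_nonneg_right _ hδ2.le
  have h1 := hM ((u - a) / δ)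
  have h2 := hM ((u - (a + δ)) / δ)
  calc |deriv (deriv smoothTransition) ((u - a) / δ) -
        deriv (deriv smoothTransition) ((u - (a + δ)) / δ)|
      ≤ |deriv (deriv smoothTransition) ((u - a) / δ)| +
          |deriv (deriv smoothTransition) ((u - (a + δ)) / δ)| := abs_sub _ _
    _ ≤ M + M := add_le_add h1 h2
    _ = 2 * M := by ring

/-- Telescoping: `Σ_{k < K} b_{a + kδ, δ}(u) = χ_{a,δ}(u) - χ_{a + Kδ, δ}(u)`. [folklore] -/
theorem sum_range_fiBump (a δ u : ℝ) (K : ℕ) :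
    ∑ k ∈ Finset.range K, fiBump (a + k * δ) δ u = fiStep a δ u - fiStep (a + K * δ) δ u := by
  have h := Finset.sum_range_sub' (fun k : ℕ => fiStep (a + k * δ) δ u) K
  simp only [Nat.cast_zero, zero_mul, add_zero] at h
  rw [← h]
  refine Finset.sum_congr rfl fun k _ => ?_
  simp only [fiBump, Nat.cast_succ]
  congr 2; ring

/-! ### The partition of `(N, 2N]` used in §4 -/

/-- The spacing `δ = θN/2` of the partition. [folklore] -/
def pouδ (N θ : ℝ) : ℝ := θ * N / 2

/-- The nodes `u_k = N(1 + θ/4) + kδ` (`N'` of (4.12) for the `k`-th piece). [folklore] -/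
def pouNode (N θ : ℝ) (k : ℕ) : ℝ := N * (1 + θ / 4) + k * pouδ N θ

/-- The `k`-th partition function `p_k = b_{u_k, δ}`: smooth, values in `[0, 1]`, supported in
`(u_k, u_k + θN) ⊆ (u_k, (1+θ)u_k]` (FI (4.12)–(4.14)). [cite: FriedlanderIwaniecAnnals1998, (4.12)-(4.14)] -/
def pouPiece (N θ : ℝ) (k : ℕ) : ℝ → ℝ := fiBump (pouNode N θ k) (pouδ N θ)

/-- The number of pieces, `K' = ⌊2/θ - 1/2⌋ - 1 ≤ 2θ⁻¹` ("One needs at most `2θ⁻¹` such partition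
functions"). [cite: FriedlanderIwaniecAnnals1998, §4 after (4.14)] -/
def pouCount (θ : ℝ) : ℕ := ⌊2 / θ - 1 / 2⌋₊ - 1

section

variable {N θ : ℝ}

/-- `δ > 0`. [folklore] -/
theorem pouδ_pos (hN : 0 < N) (hθ : 0 < θ) : 0 < pouδ N θ := by unfold pouδ; positivity

/-- `u_{k+1} = u_k + δ`. [folklore] -/
theorem pouNode_succ (N θ : ℝ) (k : ℕ) : pouNode N θ (k + 1) = pouNode N θ k + pouδ N θ := by
  simp only [pouNode, Nat.cast_succ]; ring

/-- `u_k + 2δ = u_k + θN`. [folklore] -/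
theorem pouNode_add_two_mul (N θ : ℝ) (k : ℕ) :
    pouNode N θ k + 2 * pouδ N θ = pouNode N θ k + θ * N := by
  simp only [pouδ]; ring

/-- `u_k > N`. [folklore] -/
theorem lt_pouNode (hN : 0 < N) (hθ : 0 < θ) (k : ℕ) : N < pouNode N θ k := by
  unfold pouNode
  have := pouδ_pos hN hθ
  have hk : (0 : ℝ) ≤ k := Nat.cast_nonneg k
  nlinarith

/-- `u_k + θN ≤ (1 + θ) u_k`. [folklore] -/
theorem pouNode_add_le (hN : 0 < N) (hθ : 0 < θ) (k : ℕ) :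
    pouNode N θ k + θ * N ≤ (1 + θ) * pouNode N θ k := by
  have := lt_pouNode hN hθ k
  nlinarith

/-- The last node used is below `2N`: for `k < K'`, `u_k + θN = u_{k+2} ≤ 2N`. [folklore] -/
theorem pouNode_add_le_two_mul (hN : 0 < N) (hθ : 0 < θ) {k : ℕ} (hk : k < pouCount θ) :
    pouNode N θ k + θ * N ≤ 2 * N := by
  unfold pouCount at hk
  have hfl : ((⌊2 / θ - 1 / 2⌋₊ : ℕ) : ℝ) ≤ 2 / θ - 1 / 2 := by
    apply Nat.floor_le
    have hk' : 1 ≤ ⌊2 / θ - 1 / 2⌋₊ := by omega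
    by_contra hneg
    rw [not_le] at hneg
    have := Nat.floor_eq_zero.mpr (by linarith : 2 / θ - 1 / 2 < 1)
    omega
  have hk2 : ((k + 2 : ℕ) : ℝ) ≤ 2 / θ - 1 / 2 := by
    have : k + 2 ≤ ⌊2 / θ - 1 / 2⌋₊ := by omega
    exact le_trans (by exact_mod_cast this) hfl
  unfold pouNode pouδ
  push_cast at hk2
  -- `N(1 + θ/4) + kθN/2 + θN = N(1 + θ/4 + (k+2)θ/2) ≤ 2N`
  have h1 : θ / 4 + (k + 2) * θ / 2 ≤ 1 := by
    have := mul_le_mul_of_nonneg_right hk2 (by positivity : (0 : ℝ) ≤ θ / 2)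
    field_simp at this
    nlinarith
  nlinarith

/-- `K' ≤ 2/θ`. [folklore] -/
theorem pouCount_le (hθ : 0 < θ) : (pouCount θ : ℝ) ≤ 2 / θ := by
  unfold pouCount
  have h1 : ((⌊2 / θ - 1 / 2⌋₊ - 1 : ℕ) : ℝ) ≤ (⌊2 / θ - 1 / 2⌋₊ : ℝ) := by
    exact_mod_cast Nat.sub_le _ _
  refine h1.trans ?_
  rcases le_or_gt 0 (2 / θ - 1 / 2) with h | h
  · exact (Nat.floor_le h).trans (by linarith)
  · rw [Nat.floor_of_nonpos h.le]; simp; positivity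

/-- `0 ≤ p_k ≤ 1`. [folklore] -/
theorem pouPiece_nonneg (hN : 0 < N) (hθ : 0 < θ) (k : ℕ) (u : ℝ) : 0 ≤ pouPiece N θ k u :=
  fiBump_nonneg (pouδ_pos hN hθ) u

/-- `p_k ≤ 1`. [folklore] -/
theorem pouPiece_le_one (N θ : ℝ) (k : ℕ) (u : ℝ) : pouPiece N θ k u ≤ 1 := fiBump_le_one _ _ _

/-- `|p_k| ≤ 1` ((4.14), `j = 0`). [cite: FriedlanderIwaniecAnnals1998, (4.14)] -/
theorem abs_pouPiece_le_one (hN : 0 < N) (hθ : 0 < θ) (k : ℕ) (u : ℝ) : |pouPiece N θ k u| ≤ 1 :=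
  abs_fiBump_le_one (pouδ_pos hN hθ) u

/-- Support of `p_k`: `u_k < u < u_k + θN`. [folklore] -/
theorem pouPiece_support (hN : 0 < N) (hθ : 0 < θ) {k : ℕ} {u : ℝ} (h : pouPiece N θ k u ≠ 0) :
    pouNode N θ k < u ∧ u < pouNode N θ k + θ * N := by
  have := fiBump_support (pouδ_pos hN hθ) h
  rwa [pouNode_add_two_mul] at this

/-- `p_k` is smooth. [folklore] -/
theorem contDiff_pouPiece (N θ : ℝ) (k : ℕ) {n : ℕ∞} : ContDiff ℝ n (pouPiece N θ k) :=
  contDiff_fiBump _ _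

/-- `|p_k'| ≤ 4M/(θN)`. [cite: FriedlanderIwaniecAnnals1998, (4.14)] -/
theorem abs_deriv_pouPiece_le {M : ℝ} (hM : ∀ s, |deriv Real.smoothTransition s| ≤ M)
    (hN : 0 < N) (hθ : 0 < θ) (k : ℕ) (u : ℝ) :
    |deriv (pouPiece N θ k) u| ≤ 4 * M * (θ * N)⁻¹ := by
  have h := abs_deriv_fiBump_le hM (pouNode N θ k) (pouδ_pos hN hθ) u
  refine h.trans_eq ?_
  unfold pouδ; field_simp; ring

/-- `|p_k''| ≤ 8M/(θN)²`. [cite: FriedlanderIwaniecAnnals1998, (4.14)] -/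
theorem abs_deriv_deriv_pouPiece_le {M : ℝ} (hM : ∀ s, |deriv (deriv Real.smoothTransition) s| ≤ M)
    (hN : 0 < N) (hθ : 0 < θ) (k : ℕ) (u : ℝ) :
    |deriv (deriv (pouPiece N θ k)) u| ≤ 8 * M * (θ * N)⁻¹ ^ 2 := by
  have h := abs_deriv_deriv_fiBump_le hM (pouNode N θ k) (pouδ_pos hN hθ) u
  refine h.trans_eq ?_
  unfold pouδ; field_simp; ring

/-- The partial sums of the partition: `Σ_{k < K'} p_k = χ_{u_0} - χ_{u_{K'}}`. [folklore] -/
theorem sum_pouPiece (N θ u : ℝ) :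
    ∑ k ∈ Finset.range (pouCount θ), pouPiece N θ k u =
      fiStep (pouNode N θ 0) (pouδ N θ) u - fiStep (pouNode N θ (pouCount θ)) (pouδ N θ) u := by
  have h := sum_range_fiBump (pouNode N θ 0) (pouδ N θ) u (pouCount θ)
  have e : ∀ k : ℕ, pouNode N θ 0 + k * pouδ N θ = pouNode N θ k := fun k => by
    simp [pouNode]
  simp only [e] at h
  exact h

/-- `0 ≤ Σ_k p_k ≤ 1`. [folklore] -/
theorem sum_pouPiece_mem_Icc (hN : 0 < N) (hθ : 0 < θ) (u : ℝ) :
    ∑ k ∈ Finset.range (pouCount θ), pouPiece N θ k u ∈ Set.Icc (0 : ℝ) 1 := by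
  rw [sum_pouPiece]
  have hδ := pouδ_pos hN hθ
  refine ⟨sub_nonneg.mpr (fiStep_anti_left hδ ?_ u), ?_⟩
  · unfold pouNode; have := hδ.le; simp; positivity
  · linarith [fiStep_le_one (pouNode N θ 0) (pouδ N θ) u,
      fiStep_nonneg (pouNode N θ (pouCount θ)) (pouδ N θ) u]

/-- The partition is exact on `[u_1, u_{K'}]`: there `Σ_k p_k = 1`. [folklore] -/
theorem sum_pouPiece_eq_one (hN : 0 < N) (hθ : 0 < θ) {u : ℝ} (h1 : pouNode N θ 1 ≤ u)
    (h2 : u ≤ pouNode N θ (pouCount θ)) :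
    ∑ k ∈ Finset.range (pouCount θ), pouPiece N θ k u = 1 := by
  have hδ := pouδ_pos hN hθ
  rw [sum_pouPiece, fiStep_eq_one hδ (by rw [← pouNode_succ]; exact h1), fiStep_eq_zero hδ h2]
  ring

/-- The residual zones: if `Σ_k p_k(u) ≠ 1` for some `u ∈ (N, 2N]` then `u < N + θN` or
`u > 2N - θN` (`0 < θ ≤ 1/2`). [folklore] -/
theorem residual_zone (hN : 0 < N) (hθ : 0 < θ) (hθ2 : θ ≤ 1 / 2) {u : ℝ}
    (h : ∑ k ∈ Finset.range (pouCount θ), pouPiece N θ k u ≠ 1) :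
    u < N + θ * N ∨ 2 * N - θ * N < u := by
  by_contra hc
  rw [not_or, not_lt, not_lt] at hc
  apply h
  apply sum_pouPiece_eq_one hN hθ
  · -- `u_1 = N(1 + θ/4) + θN/2 ≤ N + θN`
    unfold pouNode pouδ; push_cast; nlinarith [hc.1]
  · -- `u_{K'} ≥ 2N - θN` since `K' + 2 > 2/θ - 1/2`
    unfold pouNode pouδ pouCount
    have hfl : 2 / θ - 1 / 2 < (⌊2 / θ - 1 / 2⌋₊ : ℕ) + 1 := Nat.lt_floor_add_one _
    have h4 : (4 : ℝ) ≤ 2 / θ := by rw [le_div_iff₀ hθ]; linarith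
    have hpos : 1 ≤ ⌊2 / θ - 1 / 2⌋₊ := Nat.le_floor (by push_cast; linarith)
    have hcast : ((⌊2 / θ - 1 / 2⌋₊ - 1 : ℕ) : ℝ) = (⌊2 / θ - 1 / 2⌋₊ : ℝ) - 1 := by
      rw [Nat.cast_sub hpos]; simp
    rw [hcast]
    -- need: 2N - θN ≤ ... ≤ u ; we show node ≥ 2N - θN
    have : 2 * N - θ * N ≤ N * (1 + θ / 4) + ((⌊2 / θ - 1 / 2⌋₊ : ℝ) - 1) * (θ * N / 2) := by
      have hf : (⌊2 / θ - 1 / 2⌋₊ : ℝ) > 2 / θ - 3 / 2 := by linarith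
      have : ((⌊2 / θ - 1 / 2⌋₊ : ℝ) - 1) * (θ * N / 2) ≥ (2 / θ - 5 / 2) * (θ * N / 2) := by
        apply mul_le_mul_of_nonneg_right (by linarith) (by positivity)
      have e : (2 / θ - 5 / 2) * (θ * N / 2) = N - 5 * θ * N / 4 := by field_simp; ring
      nlinarith
    linarith [hc.2]

end

end Literature.NumberTheory.Sieve.FriedlanderIwaniecPrimes
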